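import Summits.AtomisticToContinuum.Crystallization.Theorems.SquareWellLayerCakeGapTwelveToBarlowCombinatorialLayeringTransportGlobalA
import Summits.AtomisticToContinuum.Crystallization.Theorems.SquareWellLayerCakeGapTwelveToBarlowCombinatorialLayeringTransportSteps7
import Summits.AtomisticToContinuum.Crystallization.Theorems.SquareWellLayerCakeGapTwelveToBarlowCombinatorialLayeringTransportVinv
import Summits.AtomisticToContinuum.Crystallization.Theorems.SquareWellLayerCakeGapTwelveToBarlowCombinatorialLayeringTransportAttach2
import Summits.AtomisticToContinuum.Crystallization.Theorems.SquareWellLayerCakeGapTwelveToBarlowCombinatorialLayeringTransportVComm1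
import Summits.AtomisticToContinuum.Crystallization.Theorems.PalmUnimodularRigidityShellsToBarlowChartTransportGlobalD

/-!
# Combinatorial layering (B1a of `GapTwelveToBarlow`): transport port, part `GlobalE` (finite layers)

Crux `SquareWellLayerCake.GapTwelveToBarlow` (stmt-AtomisticToContinuum-15807), line `Sketch`,
stub `stub_combinatorialLayering`, residual `(H_develop)`.  Graded forms, on a FINITE levelled
coherent plane `Φ` (valid, `(Φ i j).pt ∈ S (L i j + 4)`, `I`/`J`-coherent on the diamond
`|j| + |i| ≤ R`; the frame four inside the boundary), of the 9227 lemmas of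
`PalmUnimodularRigidityShellsToBarlowChartTransportGlobalE.lean`: the six in-layer neighbour sites
by label (`sites_inlayerFin`), the apex sites going up by `V` / seen from below (`up_of_VFin`,
`up_of_VinvFin`) and going down (`down_of_VinvFin`, `down_of_VFin`).  Proofs are those of the
source with range guards discharged by `omega` and `nbhd` replaced by `nbhdFin`
(`…TransportGlobalA`).  All `[folklore]`.
-/

noncomputable section

namespace Summit.AtomisticToContinuum.Crystallization.Theorems.SquareWellLayerCakeGapTwelveToBarlow

open Literature.Geometry.DiscreteGeometry Literature.MathematicalPhysics.StatisticalMechanics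
open Summit.AtomisticToContinuum.Crystallization.Theorems.PalmUnimodularRigidityShellsToBarlowChart hiding
  IsZChart TransportSystem scales_tied sqNormInt_transfer bond_symm nb_mem zlab_spec zlab_nb
  bond_nb_iff pattern_cases transfer_nb_nb transfer_nb_centre transfer_nb_target
  sqNormInt_zlab_centre hcp_of_mirror_pair Istep_spec Jstep_spec IinvStep_spec JinvStep_spec
  capWithAny_of_mem_cap IinvStep_Istep Istep_IinvStep JinvStep_Jstep Jstep_JinvStep polar_at_apex
  onesided_at_apex Vstep_spec nb_inj Istep_lower Jstep_lower IinvStep_lower JinvStep_lower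
  polar_at_lower_apex onesided_at_lower_apex VinvStep_spec attach_I_even attach_I_odd
  attach_lower_I_pos attach_lower_I_neg attach_J_even attach_J_odd Vstep_Istep_pt Vstep_Istep_back
  Vstep_Istep_side Vstep_Jstep_pt Vstep_Istep_comm Vstep_Jstep_comm attach_lower_J_pos
  attach_lower_J_neg VinvStep_Istep_pt VinvStep_Jstep_pt VinvStep_Istep_back VinvStep_Istep_side
  VinvStep_Istep_comm VinvStep_Jstep_comm Istep_Jstep_comm star_core table_fcc_p table_fcc_m
  table_hcp_p table_hcp_m

variable {S : ℕ → Set (EuclideanSpace ℝ (Fin 3))}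
  {B : EuclideanSpace ℝ (Fin 3) → EuclideanSpace ℝ (Fin 3) → Prop}
  {Pc : EuclideanSpace ℝ (Fin 3) → Finset (Fin 3 → ℤ)}
  {nb : EuclideanSpace ℝ (Fin 3) → (Fin 3 → ℤ) → EuclideanSpace ℝ (Fin 3)}

variable
  (hch : (∀ n : ℕ, ∀ z ∈ S n, (Pc z = fcc3Int ∨ Pc z = hcpInt) ∧
      Set.BijOn (nb z) (↑(Pc z) : Set (Fin 3 → ℤ)) {y | B z y} ∧
      ∀ t ∈ Pc z, ∀ t' ∈ Pc z, (B (nb z t) (nb z t') ↔ sqNormInt (t - t') = 18)) ∧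
    (∀ n : ℕ, ∀ z ∈ S (n + 1), ∀ y, B z y → y ∈ S n) ∧
    (∀ n m : ℕ, ∀ x ∈ S n, ∀ y ∈ S m, B x y →
      ∀ (z z' : EuclideanSpace ℝ (Fin 3)) (t t' u u' : Fin 3 → ℤ),
        (t = 0 ∧ z = x ∨ t ∈ Pc x ∧ z = nb x t) → (t' = 0 ∧ z' = x ∨ t' ∈ Pc x ∧ z' = nb x t') →
        (u = 0 ∧ z = y ∨ u ∈ Pc y ∧ z = nb y u) → (u' = 0 ∧ z' = y ∨ u' ∈ Pc y ∧ z' = nb y u') →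
        sqNormInt (u - u') = sqNormInt (t - t')) ∧
    (∀ x y, B x y → B y x))

include hch



/-- **The six in-layer neighbour sites** of a frame `⟨x, t₁, t₂, U⟩ = Φ i j` of a coherent layer
are `nb x (±t₁)`, `nb x (±t₂)`, `nb x (±(t₁ − t₂))`. [folklore] -/
theorem sites_inlayerFin {R : ℕ} {L : ℤ → ℤ → ℕ} {Φ : ℤ → ℤ → ZFrame} (hval : ∀ i j : ℤ, j.natAbs + i.natAbs ≤ R → IsFrame (Pc (Φ i j).pt) (Φ i j).t₁ (Φ i j).t₂ (Φ i j).U) (hS : ∀ i j : ℤ, j.natAbs + i.natAbs ≤ R → (Φ i j).pt ∈ S (L i j + 4)) (hI : ∀ i j : ℤ, j.natAbs + i.natAbs + 1 ≤ R → Φ (i + 1) j = Istep Pc nb (Φ i j)) (hJ : ∀ i j : ℤ, j.natAbs + 1 + i.natAbs ≤ R → Φ i (j + 1) = Jstep Pc nb (Φ i j)) (i j : ℤ)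
    (hij : j.natAbs + i.natAbs + 4 ≤ R) {x : (EuclideanSpace ℝ (Fin 3))} {t₁ t₂ : Fin 3 → ℤ} {U : Finset (Fin 3 → ℤ)} (h : Φ i j = ⟨x, t₁, t₂, U⟩) : (Φ (i + 1) j).pt = nb x t₁ ∧ (Φ (i - 1) j).pt = nb x (-t₁) ∧ (Φ i (j + 1)).pt = nb x t₂ ∧ (Φ i (j - 1)).pt = nb x (-t₂) ∧ (Φ (i - 1) (j + 1)).pt = nb x (t₂ - t₁) ∧ (Φ (i + 1) (j - 1)).pt = nb x (t₁ - t₂) := by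
  have hvalE : ∀ (i' j' : ℤ), j'.natAbs + i'.natAbs ≤ R → ∀ (E : ZFrame), Φ i' j' = E →
      IsFrame (Pc E.pt) E.t₁ E.t₂ E.U := by
    intro i' j' hr E hE; rw [← hE]; exact hval i' j' hr
  have hx : x ∈ S (L i j + 4) := by
      have := hS i j (by omega); rw [h] at this; exact this
  have hU : IsFrame (Pc x) t₁ t₂ U := hvalE i j (by omega) _ h
  -- behind along I
  rcases hm : Φ (i - 1) j with ⟨x', a, b, W⟩
  have hx' : x' ∈ S (L (i - 1) j + 4) := by
      have := hS (i - 1) j (by omega); rw [hm] at this; exact this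
  have hW : IsFrame (Pc x') a b W := hvalE (i - 1) j (by omega) _ hm
  have hrelI : (⟨x, t₁, t₂, U⟩ : ZFrame) = Istep Pc nb ⟨x', a, b, W⟩ := by
    rw [← h, ← hm, ← hI (i - 1) j (by omega), Int.sub_add_cancel]
  obtain ⟨-, hbackI, hvalI⟩ := back_I hch hx' hW hU hrelI
  -- behind along J
  rcases hn : Φ i (j - 1) with ⟨x'', a', b', W'⟩
  have hx'' : x'' ∈ S (L i (j - 1) + 4) := by
      have := hS i (j - 1) (by omega); rw [hn] at this; exact this
  have hW' : IsFrame (Pc x'') a' b' W' := hvalE i (j - 1) (by omega) _ hn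
  have hrelJ : (⟨x, t₁, t₂, U⟩ : ZFrame) = Jstep Pc nb ⟨x'', a', b', W'⟩ := by
    rw [← h, ← hn, ← hJ i (j - 1) (by omega), Int.sub_add_cancel]
  obtain ⟨-, hbackJ, hvalJ⟩ := back_J hch hx'' hW' hU hrelJ
  refine ⟨by rw [hI i j (by omega), h]; rfl, hbackI.symm, by rw [hJ i j (by omega), h]; rfl, hbackJ.symm, ?_, ?_⟩
  · -- `Φ (i−1) (j+1) = J (Φ (i−1) j)`: its point is `nb x' b`, the common neighbour labelled `v = t₂ − t₁` at `x`
    obtain ⟨-, -, -, -, -, hvnb, -⟩ := Istep_spec hch hx' hW (hregI_of_valid (Pc := Pc) (nb := nb) hvalI)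
    have hxe : x = nb x' a := congrArg ZFrame.pt hrelI
    have ht₁e : t₁ = -zlab Pc nb (nb x' a) x' := congrArg ZFrame.t₁ hrelI
    have ht₂e : t₂ = zlab Pc nb (nb x' a) (nb x' b) - zlab Pc nb (nb x' a) x' := congrArg ZFrame.t₂ hrelI
    rw [hJ (i - 1) j (by omega), hm]
    show nb x' b = nb x (t₂ - t₁)
    rw [hxe, ht₁e, ht₂e, show zlab Pc nb (nb x' a) (nb x' b) - zlab Pc nb (nb x' a) x' - -zlab Pc nb (nb x' a) x' =
      zlab Pc nb (nb x' a) (nb x' b) by abel]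
    exact hvnb.symm
  · obtain ⟨-, -, -, -, -, hvnb, -⟩ := Jstep_spec hch hx'' hW' (hregJ_of_valid (Pc := Pc) (nb := nb) hvalJ)
    have hxe : x = nb x'' b' := congrArg ZFrame.pt hrelJ
    have ht₁e : t₁ = zlab Pc nb (nb x'' b') (nb x'' a') - zlab Pc nb (nb x'' b') x'' := congrArg ZFrame.t₁ hrelJ
    have ht₂e : t₂ = -zlab Pc nb (nb x'' b') x'' := congrArg ZFrame.t₂ hrelJ
    rw [hI i (j - 1) (by omega), hn]
    show nb x'' a' = nb x (t₁ - t₂)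
    rw [hxe, ht₁e, ht₂e, show zlab Pc nb (nb x'' b') (nb x'' a') - zlab Pc nb (nb x'' b') x'' - -zlab Pc nb (nb x'' b') x'' =
      zlab Pc nb (nb x'' b') (nb x'' a') by abel]
    exact hvnb.symm

/-- **Upper sites, going up by `V`**: for a frame `g = Φ i j` of a coherent layer, the apex site
of `V g` is `nb x c` and the apex sites of the `V`-images of its I/J-neighbours are
`nb x (c ∓ t₁)`, `nb x (c ∓ t₂)` (sign by parity). [folklore] -/
theorem up_of_VFin {R : ℕ} {L : ℤ → ℤ → ℕ} {Φ : ℤ → ℤ → ZFrame}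
    (hval : ∀ i j : ℤ, j.natAbs + i.natAbs ≤ R → IsFrame (Pc (Φ i j).pt) (Φ i j).t₁ (Φ i j).t₂ (Φ i j).U)
    (hS : ∀ i j : ℤ, j.natAbs + i.natAbs ≤ R → (Φ i j).pt ∈ S (L i j + 4)) (hI : ∀ i j : ℤ, j.natAbs + i.natAbs + 1 ≤ R → Φ (i + 1) j = Istep Pc nb (Φ i j))
    (hJ : ∀ i j : ℤ, j.natAbs + 1 + i.natAbs ≤ R → Φ i (j + 1) = Jstep Pc nb (Φ i j)) (i j : ℤ)
    (hij : j.natAbs + i.natAbs + 4 ≤ R) {x : (EuclideanSpace ℝ (Fin 3))} {t₁ t₂ : Fin 3 → ℤ}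
    {U : Finset (Fin 3 → ℤ)} (h : Φ i j = ⟨x, t₁, t₂, U⟩) :
    (Vstep Pc nb (Φ i j)).pt = nb x (apexOf t₁ t₂ U) ∧
    (frameParity t₁ t₂ U = 1 → (Vstep Pc nb (Φ (i - 1) j)).pt = nb x (apexOf t₁ t₂ U - t₁) ∧
      (Vstep Pc nb (Φ i (j - 1))).pt = nb x (apexOf t₁ t₂ U - t₂)) ∧
    (frameParity t₁ t₂ U = -1 → (Vstep Pc nb (Φ (i + 1) j)).pt = nb x (apexOf t₁ t₂ U + t₁) ∧
      (Vstep Pc nb (Φ i (j + 1))).pt = nb x (apexOf t₁ t₂ U + t₂)) := by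
  have hvalE : ∀ (i' j' : ℤ), j'.natAbs + i'.natAbs ≤ R → ∀ (E : ZFrame), Φ i' j' = E →
      IsFrame (Pc E.pt) E.t₁ E.t₂ E.U := by
    intro i' j' hr E hE; rw [← hE]; exact hval i' j' hr
  obtain ⟨hx, hU, hIg, hJg, -⟩ := nbhdFin hch (L := fun i j => L i j + 3) hval (fun i j hr => hS i j hr) hI hJ i j (by omega) h
  have hregI := hregI_of_valid (Pc := Pc) (nb := nb) hIg
  have hregJ := hregJ_of_valid (Pc := Pc) (nb := nb) hJg
  refine ⟨by rw [h]; rfl, fun hpar => ⟨?_, ?_⟩, fun hpar => ⟨?_, ?_⟩⟩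
  · rcases hm : Φ (i - 1) j with ⟨x', a, b, W⟩
    have hx' : x' ∈ S (L (i - 1) j + 4) := by
      have := hS (i - 1) j (by omega); rw [hm] at this; exact this
    have hW : IsFrame (Pc x') a b W := hvalE (i - 1) j (by omega) _ hm
    have hrelI : (⟨x, t₁, t₂, U⟩ : ZFrame) = Istep Pc nb ⟨x', a, b, W⟩ := by
      rw [← h, ← hm, ← hI (i - 1) j (by omega), Int.sub_add_cancel]
    obtain ⟨-, -, hvalI⟩ := back_I hch hx' hW hU hrelI
    have hreg := hregI_of_valid (Pc := Pc) (nb := nb) hvalI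
    obtain ⟨-, -, -, -, -, -, -, -, -, -, -, -, hparI, -⟩ := Istep_spec hch hx' hW hreg
    have hparW : frameParity a b W = 1 := by rw [← hparI, ← hrelI]; exact hpar
    have hatt := (attach_I_even hch hx' hW hparW hreg).1
    rw [← hrelI] at hatt
    have hxe : x = nb x' a := congrArg ZFrame.pt hrelI
    show nb x' (apexOf a b W) = nb x (apexOf t₁ t₂ U - t₁)
    rw [hxe]; exact hatt.symm
  · rcases hn : Φ i (j - 1) with ⟨x', a, b, W⟩
    have hx' : x' ∈ S (L i (j - 1) + 4) := by
      have := hS i (j - 1) (by omega); rw [hn] at this; exact this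
    have hW : IsFrame (Pc x') a b W := hvalE i (j - 1) (by omega) _ hn
    have hrelJ : (⟨x, t₁, t₂, U⟩ : ZFrame) = Jstep Pc nb ⟨x', a, b, W⟩ := by
      rw [← h, ← hn, ← hJ i (j - 1) (by omega), Int.sub_add_cancel]
    obtain ⟨-, -, hvalJ⟩ := back_J hch hx' hW hU hrelJ
    have hreg := hregJ_of_valid (Pc := Pc) (nb := nb) hvalJ
    obtain ⟨-, -, -, -, -, -, -, -, -, -, -, -, hparJ', -⟩ := Jstep_spec hch hx' hW hreg
    have hparW : frameParity a b W = 1 := by rw [← hparJ', ← hrelJ]; exact hpar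
    have hatt := (attach_J_even hch hx' hW hparW hreg).1
    rw [← hrelJ] at hatt
    have hxe : x = nb x' b := congrArg ZFrame.pt hrelJ
    show nb x' (apexOf a b W) = nb x (apexOf t₁ t₂ U - t₂)
    rw [hxe]; exact hatt.symm
  · rw [hI i j (by omega), h]; exact (attach_I_odd hch hx hU hpar hregI).1
  · rw [hJ i j (by omega), h]; exact (attach_J_odd hch hx hU hpar hregJ).1

/-- **Upper sites, seen from below a layer** (`g = V⁻¹ hh`): the upper cap sites of `g` are the
point of `hh` and its `I^{∓1}`, `J^{∓1}`-neighbours. [folklore] -/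
theorem up_of_VinvFin {R : ℕ} {L : ℤ → ℤ → ℕ} {Φ : ℤ → ℤ → ZFrame}
    (hval : ∀ i j : ℤ, j.natAbs + i.natAbs ≤ R → IsFrame (Pc (Φ i j).pt) (Φ i j).t₁ (Φ i j).t₂ (Φ i j).U)
    (hS : ∀ i j : ℤ, j.natAbs + i.natAbs ≤ R → (Φ i j).pt ∈ S (L i j + 4)) (hI : ∀ i j : ℤ, j.natAbs + i.natAbs + 1 ≤ R → Φ (i + 1) j = Istep Pc nb (Φ i j))
    (hJ : ∀ i j : ℤ, j.natAbs + 1 + i.natAbs ≤ R → Φ i (j + 1) = Jstep Pc nb (Φ i j)) (i j : ℤ)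
    (hij : j.natAbs + i.natAbs + 4 ≤ R) {x : (EuclideanSpace ℝ (Fin 3))} {t₁ t₂ : Fin 3 → ℤ}
    {U : Finset (Fin 3 → ℤ)} (h : VinvStep Pc nb (Φ i j) = ⟨x, t₁, t₂, U⟩) :
    (Φ i j).pt = nb x (apexOf t₁ t₂ U) ∧
    (frameParity t₁ t₂ U = 1 → (Φ (i - 1) j).pt = nb x (apexOf t₁ t₂ U - t₁) ∧
      (Φ i (j - 1)).pt = nb x (apexOf t₁ t₂ U - t₂)) ∧
    (frameParity t₁ t₂ U = -1 → (Φ (i + 1) j).pt = nb x (apexOf t₁ t₂ U + t₁) ∧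
      (Φ i (j + 1)).pt = nb x (apexOf t₁ t₂ U + t₂)) := by
  rcases hq : Φ i j with ⟨xh, ah, bh, Wh⟩
  obtain ⟨hxh, hWh, hIg, hJg, hIig, hJig, -⟩ := nbhdFin hch (L := fun i j => L i j + 3) hval (fun i j hr => hS i j hr) hI hJ i j (by omega) hq
  obtain ⟨e1, e2, e3, e4, -, -⟩ := sites_inlayerFin hch hval hS hI hJ i j (by omega) hq
  rw [hq] at h
  have hxe : x = nb xh (apexOf ah bh (lowerCap (Pc xh) ah bh Wh)) := (congrArg ZFrame.pt h).symm
  have ht₁e : (VinvStep Pc nb ⟨xh, ah, bh, Wh⟩).t₁ = t₁ := congrArg ZFrame.t₁ h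
  have ht₂e : (VinvStep Pc nb ⟨xh, ah, bh, Wh⟩).t₂ = t₂ := congrArg ZFrame.t₂ h
  have hUe : (VinvStep Pc nb ⟨xh, ah, bh, Wh⟩).U = U := congrArg ZFrame.U h
  obtain ⟨-, hdS, -, hξP, hξx, hframeVi, hparVi, hbr⟩ := VinvStep_spec hch hxh hWh hIg hJg hIig hJig
  rw [← hxe] at hdS hξP hξx hframeVi hbr
  rw [ht₁e, ht₂e, hUe] at hbr hparVi hframeVi
  have hPx := pattern_cases hch hdS
  have hU : IsFrame (Pc x) t₁ t₂ U := hframeVi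
  rcases hbr with ⟨hlp, hUd, hnI, hnJ, -⟩ | ⟨hlp, hUd, hnI, hnJ, -⟩
  · have hapex : apexOf t₁ t₂ U = zlab Pc nb x xh := apexOf_eq_of_form hPx hU (by rw [hUd]; simp) (Or.inl hUd)
    rw [hapex]
    refine ⟨hξx.symm, fun _ => ⟨?_, ?_⟩, fun hpar => ?_⟩
    · rw [e2]; exact hnI.symm
    · rw [e4]; exact hnJ.symm
    · exfalso; rw [hparVi, hlp] at hpar; norm_num at hpar
  · have hapex : apexOf t₁ t₂ U = zlab Pc nb x xh := apexOf_eq_of_form hPx hU (by rw [hUd]; simp) (Or.inr hUd)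
    rw [hapex]
    refine ⟨hξx.symm, fun hpar => ?_, fun _ => ⟨?_, ?_⟩⟩
    · exfalso; rw [hparVi, hlp] at hpar; norm_num at hpar
    · rw [e1]; exact hnI.symm
    · rw [e3]; exact hnJ.symm

/-- **Lower sites, going down by `V⁻¹`**: for a frame `g = Φ i j` of a coherent layer, the apex
site of `V⁻¹ g` is `nb x d` and the apex sites of the `V⁻¹`-images of its I/J-neighbours are
`nb x (d ± t₁)`, `nb x (d ± t₂)` (sign by the letter read below). [folklore] -/
theorem down_of_VinvFin {R : ℕ} {L : ℤ → ℤ → ℕ} {Φ : ℤ → ℤ → ZFrame}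
    (hval : ∀ i j : ℤ, j.natAbs + i.natAbs ≤ R → IsFrame (Pc (Φ i j).pt) (Φ i j).t₁ (Φ i j).t₂ (Φ i j).U)
    (hS : ∀ i j : ℤ, j.natAbs + i.natAbs ≤ R → (Φ i j).pt ∈ S (L i j + 4)) (hI : ∀ i j : ℤ, j.natAbs + i.natAbs + 1 ≤ R → Φ (i + 1) j = Istep Pc nb (Φ i j))
    (hJ : ∀ i j : ℤ, j.natAbs + 1 + i.natAbs ≤ R → Φ i (j + 1) = Jstep Pc nb (Φ i j)) (i j : ℤ)
    (hij : j.natAbs + i.natAbs + 4 ≤ R) {x : (EuclideanSpace ℝ (Fin 3))} {t₁ t₂ : Fin 3 → ℤ}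
    {U : Finset (Fin 3 → ℤ)} (h : Φ i j = ⟨x, t₁, t₂, U⟩) :
    (VinvStep Pc nb (Φ i j)).pt = nb x (apexOf t₁ t₂ (lowerCap (Pc x) t₁ t₂ U)) ∧
    (lowerParity t₁ t₂ (lowerCap (Pc x) t₁ t₂ U) = 1 →
      (VinvStep Pc nb (Φ (i + 1) j)).pt = nb x (apexOf t₁ t₂ (lowerCap (Pc x) t₁ t₂ U) + t₁) ∧
      (VinvStep Pc nb (Φ i (j + 1))).pt = nb x (apexOf t₁ t₂ (lowerCap (Pc x) t₁ t₂ U) + t₂)) ∧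
    (lowerParity t₁ t₂ (lowerCap (Pc x) t₁ t₂ U) = -1 →
      (VinvStep Pc nb (Φ (i - 1) j)).pt = nb x (apexOf t₁ t₂ (lowerCap (Pc x) t₁ t₂ U) - t₁) ∧
      (VinvStep Pc nb (Φ i (j - 1))).pt = nb x (apexOf t₁ t₂ (lowerCap (Pc x) t₁ t₂ U) - t₂)) := by
  have hvalE : ∀ (i' j' : ℤ), j'.natAbs + i'.natAbs ≤ R → ∀ (E : ZFrame), Φ i' j' = E →
      IsFrame (Pc E.pt) E.t₁ E.t₂ E.U := by
    intro i' j' hr E hE; rw [← hE]; exact hval i' j' hr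
  obtain ⟨hx, hU, hIg, hJg, -⟩ := nbhdFin hch (L := fun i j => L i j + 3) hval (fun i j hr => hS i j hr) hI hJ i j (by omega) h
  have hregI := hregI_of_valid (Pc := Pc) (nb := nb) hIg
  have hregJ := hregJ_of_valid (Pc := Pc) (nb := nb) hJg
  refine ⟨by rw [h]; rfl, fun hlp => ⟨?_, ?_⟩, fun hlp => ⟨?_, ?_⟩⟩
  · rw [hI i j (by omega), h]; exact (attach_lower_I_pos hch hx hU hlp hregI).2.1
  · rw [hJ i j (by omega), h]; exact (attach_lower_J_pos hch hx hU hlp hregJ).2.1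
  · rcases hm : Φ (i - 1) j with ⟨x', a, b, W⟩
    have hx' : x' ∈ S (L (i - 1) j + 4) := by
      have := hS (i - 1) j (by omega); rw [hm] at this; exact this
    have hW : IsFrame (Pc x') a b W := hvalE (i - 1) j (by omega) _ hm
    have hrelI : (⟨x, t₁, t₂, U⟩ : ZFrame) = Istep Pc nb ⟨x', a, b, W⟩ := by
      rw [← h, ← hm, ← hI (i - 1) j (by omega), Int.sub_add_cancel]
    obtain ⟨-, -, hvalI⟩ := back_I hch hx' hW hU hrelI
    have hreg := hregI_of_valid (Pc := Pc) (nb := nb) hvalI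
    have hxe : x = nb x' a := congrArg ZFrame.pt hrelI
    have hlpW : lowerParity a b (lowerCap (Pc x') a b W) = -1 := by
      rcases lowerParity_eq_or a b (lowerCap (Pc x') a b W) with h1 | h1
      · exfalso
        have := (attach_lower_I_pos hch hx' hW h1 hreg).1
        rw [← hrelI, ← hxe] at this
        change lowerParity t₁ t₂ (lowerCap (Pc x) t₁ t₂ U) = 1 at this
        rw [hlp] at this; norm_num at this
      · exact h1
    have hatt := (attach_lower_I_neg hch hx' hW hlpW hreg).2.1
    rw [← hrelI, ← hxe] at hatt
    show nb x' (apexOf a b (lowerCap (Pc x') a b W)) = _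
    exact hatt.symm
  · rcases hn : Φ i (j - 1) with ⟨x', a, b, W⟩
    have hx' : x' ∈ S (L i (j - 1) + 4) := by
      have := hS i (j - 1) (by omega); rw [hn] at this; exact this
    have hW : IsFrame (Pc x') a b W := hvalE i (j - 1) (by omega) _ hn
    have hrelJ : (⟨x, t₁, t₂, U⟩ : ZFrame) = Jstep Pc nb ⟨x', a, b, W⟩ := by
      rw [← h, ← hn, ← hJ i (j - 1) (by omega), Int.sub_add_cancel]
    obtain ⟨-, -, hvalJ⟩ := back_J hch hx' hW hU hrelJ
    have hreg := hregJ_of_valid (Pc := Pc) (nb := nb) hvalJ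
    have hxe : x = nb x' b := congrArg ZFrame.pt hrelJ
    have hlpW : lowerParity a b (lowerCap (Pc x') a b W) = -1 := by
      rcases lowerParity_eq_or a b (lowerCap (Pc x') a b W) with h1 | h1
      · exfalso
        have := (attach_lower_J_pos hch hx' hW h1 hreg).1
        rw [← hrelJ, ← hxe] at this
        change lowerParity t₁ t₂ (lowerCap (Pc x) t₁ t₂ U) = 1 at this
        rw [hlp] at this; norm_num at this
      · exact h1
    have hatt := (attach_lower_J_neg hch hx' hW hlpW hreg).2.1
    rw [← hrelJ, ← hxe] at hatt
    show nb x' (apexOf a b (lowerCap (Pc x') a b W)) = _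
    exact hatt.symm

/-- **Lower sites, seen from above a layer** (`g = V hh`): the lower cap sites of `g` are the
point of `hh` and its `I^{±1}`, `J^{±1}`-neighbours. [folklore] -/
theorem down_of_VFin {R : ℕ} {L : ℤ → ℤ → ℕ} {Φ : ℤ → ℤ → ZFrame}
    (hval : ∀ i j : ℤ, j.natAbs + i.natAbs ≤ R → IsFrame (Pc (Φ i j).pt) (Φ i j).t₁ (Φ i j).t₂ (Φ i j).U)
    (hS : ∀ i j : ℤ, j.natAbs + i.natAbs ≤ R → (Φ i j).pt ∈ S (L i j + 4)) (hI : ∀ i j : ℤ, j.natAbs + i.natAbs + 1 ≤ R → Φ (i + 1) j = Istep Pc nb (Φ i j))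
    (hJ : ∀ i j : ℤ, j.natAbs + 1 + i.natAbs ≤ R → Φ i (j + 1) = Jstep Pc nb (Φ i j)) (i j : ℤ)
    (hij : j.natAbs + i.natAbs + 4 ≤ R) {x : (EuclideanSpace ℝ (Fin 3))} {t₁ t₂ : Fin 3 → ℤ}
    {U : Finset (Fin 3 → ℤ)} (h : Vstep Pc nb (Φ i j) = ⟨x, t₁, t₂, U⟩) :
    (Φ i j).pt = nb x (apexOf t₁ t₂ (lowerCap (Pc x) t₁ t₂ U)) ∧
    (lowerParity t₁ t₂ (lowerCap (Pc x) t₁ t₂ U) = 1 →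
      (Φ (i + 1) j).pt = nb x (apexOf t₁ t₂ (lowerCap (Pc x) t₁ t₂ U) + t₁) ∧
      (Φ i (j + 1)).pt = nb x (apexOf t₁ t₂ (lowerCap (Pc x) t₁ t₂ U) + t₂)) ∧
    (lowerParity t₁ t₂ (lowerCap (Pc x) t₁ t₂ U) = -1 →
      (Φ (i - 1) j).pt = nb x (apexOf t₁ t₂ (lowerCap (Pc x) t₁ t₂ U) - t₁) ∧
      (Φ i (j - 1)).pt = nb x (apexOf t₁ t₂ (lowerCap (Pc x) t₁ t₂ U) - t₂)) := by
  rcases hq : Φ i j with ⟨xh, ah, bh, Wh⟩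
  obtain ⟨hxh, hWh, hIg, hJg, hIig, hJig, -⟩ := nbhdFin hch (L := fun i j => L i j + 3) hval (fun i j hr => hS i j hr) hI hJ i j (by omega) hq
  obtain ⟨e1, e2, e3, e4, -, -⟩ := sites_inlayerFin hch hval hS hI hJ i j (by omega) hq
  rw [hq] at h
  have hxe : x = nb xh (apexOf ah bh Wh) := (congrArg ZFrame.pt h).symm
  have ht₁e : (Vstep Pc nb ⟨xh, ah, bh, Wh⟩).t₁ = t₁ := congrArg ZFrame.t₁ h
  have ht₂e : (Vstep Pc nb ⟨xh, ah, bh, Wh⟩).t₂ = t₂ := congrArg ZFrame.t₂ h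
  have hUe : (Vstep Pc nb ⟨xh, ah, bh, Wh⟩).U = U := congrArg ZFrame.U h
  obtain ⟨-, huS, -, hξP, hξx, hframeV, hlpV, hbr⟩ := Vstep_spec hch hxh hWh hIg hJg hIig hJig
  rw [← hxe] at huS hξP hξx hframeV hbr hlpV
  rw [ht₁e, ht₂e, hUe] at hbr hlpV hframeV
  have hPx := pattern_cases hch huS
  have hU : IsFrame (Pc x) t₁ t₂ U := hframeV
  have hL := isFrame_lowerCap hPx hU
  rcases hbr with ⟨hparh, hLd, hnI, hnJ, -⟩ | ⟨hparh, hLd, hnI, hnJ, -⟩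
  · have hapex : apexOf t₁ t₂ (lowerCap (Pc x) t₁ t₂ U) = zlab Pc nb x xh :=
      apexOf_eq_of_form hPx hL (by rw [hLd]; simp) (Or.inr hLd)
    rw [hapex]
    refine ⟨hξx.symm, fun _ => ⟨?_, ?_⟩, fun hlp => ?_⟩
    · rw [e1]; exact hnI.symm
    · rw [e3]; exact hnJ.symm
    · exfalso; rw [hlpV, hparh] at hlp; norm_num at hlp
  · have hapex : apexOf t₁ t₂ (lowerCap (Pc x) t₁ t₂ U) = zlab Pc nb x xh :=
      apexOf_eq_of_form hPx hL (by rw [hLd]; simp) (Or.inl hLd)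
    rw [hapex]
    refine ⟨hξx.symm, fun hlp => ?_, fun _ => ⟨?_, ?_⟩⟩
    · exfalso; rw [hlpV, hparh] at hlp; norm_num at hlp
    · rw [e2]; exact hnI.symm
    · rw [e4]; exact hnJ.symm

/-! ## Registered anchor (closed form) -/

omit hch in
/-- **Closed form of `sites_inlayerFin`** (the registered anchor of this file): the section data
`S, B, Pc, nb` and the standing hypothesis written out (two hypotheses regrouped). [folklore] -/
theorem sites_inlayerFin_graded :
    ∀ {S : ℕ → Set (EuclideanSpace ℝ (Fin 3))} {B : EuclideanSpace ℝ (Fin 3) → EuclideanSpace ℝ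
    (Fin 3) → Prop} {Pc : EuclideanSpace ℝ (Fin 3) → Finset (Fin 3 → ℤ)} {nb : EuclideanSpace ℝ
    (Fin 3) → (Fin 3 → ℤ) → EuclideanSpace ℝ (Fin 3)}, ((∀ n : ℕ, ∀ z ∈ S n, (Pc z =
    Summit.AtomisticToContinuum.Crystallization.Theorems.PalmUnimodularRigidityShellsToBarlowChart.fcc3Int
    ∨ Pc z = Literature.Geometry.DiscreteGeometry.hcpInt) ∧ Set.BijOn (nb z) (↑(Pc z) : Set (Fin
    3 → ℤ)) {y | B z y} ∧ ∀ t ∈ Pc z, ∀ t' ∈ Pc z, (B (nb z t) (nb z t') ↔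
    Literature.Geometry.DiscreteGeometry.sqNormInt (t - t') = 18)) ∧ (∀ n : ℕ, ∀ z ∈ S (n + 1),
    ∀ y, B z y → y ∈ S n) ∧ (∀ n m : ℕ, ∀ x ∈ S n, ∀ y ∈ S m, B x y → ∀ (z z' : EuclideanSpace ℝ
    (Fin 3)) (t t' u u' : Fin 3 → ℤ), (t = 0 ∧ z = x ∨ t ∈ Pc x ∧ z = nb x t) → (t' = 0 ∧ z' = x
    ∨ t' ∈ Pc x ∧ z' = nb x t') → (u = 0 ∧ z = y ∨ u ∈ Pc y ∧ z = nb y u) → (u' = 0 ∧ z' = y ∨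
    u' ∈ Pc y ∧ z' = nb y u') → Literature.Geometry.DiscreteGeometry.sqNormInt (u - u') =
    Literature.Geometry.DiscreteGeometry.sqNormInt (t - t')) ∧ (∀ x y, B x y → B y x)) → ∀ {R :
    ℕ} {L : ℤ → ℤ → ℕ} {Φ : ℤ → ℤ →
    Summit.AtomisticToContinuum.Crystallization.Theorems.PalmUnimodularRigidityShellsToBarlowChart.ZFrame}
    (i j : ℤ) {x : (EuclideanSpace ℝ (Fin 3))} {t₁ t₂ : Fin 3 → ℤ} {U : Finset (Fin 3 → ℤ)}, (∀
    i j : ℤ, j.natAbs + i.natAbs ≤ R → (Φ i j).pt ∈ S (L i j + 4)) → (∀ i j : ℤ, j.natAbs +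
    i.natAbs ≤ R →
    Summit.AtomisticToContinuum.Crystallization.Theorems.PalmUnimodularRigidityShellsToBarlowChart.IsFrame
    (Pc (Φ i j).pt) (Φ i j).t₁ (Φ i j).t₂ (Φ i j).U) → (∀ i j : ℤ, j.natAbs + i.natAbs + 1 ≤ R →
    Φ (i + 1) j =
    Summit.AtomisticToContinuum.Crystallization.Theorems.PalmUnimodularRigidityShellsToBarlowChart.Istep
    Pc nb (Φ i j)) → (∀ i j : ℤ, j.natAbs + 1 + i.natAbs ≤ R → Φ i (j + 1) =
    Summit.AtomisticToContinuum.Crystallization.Theorems.PalmUnimodularRigidityShellsToBarlowChart.Jstep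
    Pc nb (Φ i j)) → j.natAbs + i.natAbs + 4 ≤ R → Φ i j = ⟨x, t₁, t₂, U⟩ → (Φ (i + 1) j).pt =
    nb x t₁ ∧ (Φ (i - 1) j).pt = nb x (-t₁) ∧ (Φ i (j + 1)).pt = nb x t₂ ∧ (Φ i (j - 1)).pt = nb
    x (-t₂) ∧ (Φ (i - 1) (j + 1)).pt = nb x (t₂ - t₁) ∧ (Φ (i + 1) (j - 1)).pt = nb x (t₁ - t₂) := by
  intro S B Pc nb hch R L Φ i j x t₁ t₂ U hS hval hI hJ hij h
  exact sites_inlayerFin hch hval hS hI hJ i j hij h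

end Summit.AtomisticToContinuum.Crystallization.Theorems.SquareWellLayerCakeGapTwelveToBarlow

end
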